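import Summits.Ventures.PercRepro.ProfilePointedCircuitClassesStarSharpLoopC

/-!
# PercRepro — THE DEFECT COUNT OF `StarNineSharp`, PART A: DEFECTS OF A DEMAND CLASS AND THEIR C-POINT TARGETS
(p5, gen 55; `proofs/P5-GM1.md` §82 ADD 2–4)

The count `|bad| ≤ |C|` is the same in the loop regime and in the parallel regimes `b ∥ e`, `b ∥ f`: the BAD demands
of a class `P ⊆ d0DON` (no swap in `R`: `hP`) are B1 or B2 defects of `R`, and the C-points give targets `{e, f, x} + b`
in a target set `T` (`htgt`).  This part: the defect data (`defect_data_of_P`, with a C-endpoint by `c_point_exists`),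
two and three targets from distinct C-points, the other endpoint of a defect (`pair_of_defect`), the shared-endpoint
lemma packaged on `d0DON` (`two_more_cpoints_of_P`), the count for at most two defects
(`card_bad_le_targets_of_card_le_two_P`) and the identities used by parts B, C.
-/

open scoped Matroid

namespace PercRepro.Cogirth

open Finset ThmH Skew Shadow Profile

open Classical

variable {α : Type} [DecidableEq α] {N : Matroid α} [N.Finite]

section StarSharpDefectA

variable {b b' : α}

omit [DecidableEq α] in
/-- A finset without four distinct elements has at most three elements. -/
theorem card_le_three_of_no_four {s : Finset α}
    (h : ∀ x ∈ s, ∀ y ∈ s, ∀ z ∈ s, ∀ w ∈ s, x = y ∨ x = z ∨ x = w ∨ y = z ∨ y = w ∨ z = w) : s.card ≤ 3 := by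
  classical
  by_contra hlt
  push Not at hlt
  obtain ⟨x, hx⟩ := card_pos.1 (by omega : 0 < s.card)
  have h3 : 2 < (s.erase x).card := by rw [card_erase_of_mem hx]; omega
  obtain ⟨y, z, w, hy, hz, hw, hyz, hyw, hzw⟩ := two_lt_card_iff.1 h3
  have hxy : x ≠ y := fun h' => (mem_erase.1 hy).1 h'.symm
  have hxz : x ≠ z := fun h' => (mem_erase.1 hz).1 h'.symm
  have hxw : x ≠ w := fun h' => (mem_erase.1 hw).1 h'.symm
  rcases h x hx y (mem_of_mem_erase hy) z (mem_of_mem_erase hz) w (mem_of_mem_erase hw) with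
    h1 | h1 | h1 | h1 | h1 | h1
  · exact hxy h1
  · exact hxz h1
  · exact hxw h1
  · exact hyz h1
  · exact hyw h1
  · exact hzw h1

/-- Two distinct C-points give two ON targets. -/
theorem two_le_card_targets_of_P {e f : α} {T : Finset (Finset α)}
    (htgt : ∀ x ∈ ((((gr N).erase b).erase b').erase f).erase e, rk N {e, f, x} = 3 →
      rk N ((((((gr N).erase b).erase b').erase f).erase e).erase x) = 4 → insert b {e, f, x} ∈ T)
    {x y : α} (hxy : x ≠ y) (hx : x ∈ ((((gr N).erase b).erase b').erase f).erase e)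
    (hy : y ∈ ((((gr N).erase b).erase b').erase f).erase e) (hefx : rk N {e, f, x} = 3)
    (hx4 : rk N ((((((gr N).erase b).erase b').erase f).erase e).erase x) = 4) (hefy : rk N {e, f, y} = 3)
    (hy4 : rk N ((((((gr N).erase b).erase b').erase f).erase e).erase y) = 4) :
    2 ≤ T.card := by
  have h1 := htgt x hx hefx hx4
  have h2 := htgt y hy hefy hy4
  have hsub : ({insert b {e, f, x}, insert b {e, f, y}} : Finset (Finset α)) ⊆ T := by
    intro W hW
    simp only [mem_insert, mem_singleton] at hW
    rcases hW with rfl | rfl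
    · exact h1
    · exact h2
  have := card_le_card hsub
  rw [card_pair (fun h' => hxy (cpoint_target_injective hx h'))] at this
  exact this

/-- Three distinct C-points give three ON targets. -/
theorem three_le_card_targets_of_P {e f : α} {T : Finset (Finset α)}
    (htgt : ∀ x ∈ ((((gr N).erase b).erase b').erase f).erase e, rk N {e, f, x} = 3 →
      rk N ((((((gr N).erase b).erase b').erase f).erase e).erase x) = 4 → insert b {e, f, x} ∈ T)
    {x y z : α} (hxy : x ≠ y) (hxz : x ≠ z) (hyz : y ≠ z)
    (hx : x ∈ ((((gr N).erase b).erase b').erase f).erase e) (hy : y ∈ ((((gr N).erase b).erase b').erase f).erase e)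
    (hz : z ∈ ((((gr N).erase b).erase b').erase f).erase e)
    (hefx : rk N {e, f, x} = 3) (hx4 : rk N ((((((gr N).erase b).erase b').erase f).erase e).erase x) = 4)
    (hefy : rk N {e, f, y} = 3) (hy4 : rk N ((((((gr N).erase b).erase b').erase f).erase e).erase y) = 4)
    (hefz : rk N {e, f, z} = 3) (hz4 : rk N ((((((gr N).erase b).erase b').erase f).erase e).erase z) = 4) :
    3 ≤ T.card := by
  have h1 := htgt x hx hefx hx4
  have h2 := htgt y hy hefy hy4
  have h3 := htgt z hz hefz hz4
  have hsub : ({insert b {e, f, x}, insert b {e, f, y}, insert b {e, f, z}} : Finset (Finset α)) ⊆ T := by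
    intro W hW
    simp only [mem_insert, mem_singleton] at hW
    rcases hW with rfl | rfl | rfl
    · exact h1
    · exact h2
    · exact h3
  have := card_le_card hsub
  rw [card_insert_of_notMem, card_pair (fun h' => hyz (cpoint_target_injective hy h'))] at this
  · exact this
  · simp only [mem_insert, mem_singleton, not_or]
    exact ⟨fun h' => hxy (cpoint_target_injective hx h'), fun h' => hxz (cpoint_target_injective hx h')⟩

/-- The data of a defect (a demand of the class `P` without a swap in `R`): its pair, the facts, and a C-endpoint. -/
theorem defect_data_of_P (hn : (gr N).card = 9) (h : SeriesPair N b b')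
    {e f : α} (he : e ∈ gr N) (hf : f ∈ gr N) (hef : e ≠ f) (heb : e ≠ b) (heb' : e ≠ b') (hfb : f ≠ b) (hfb' : f ≠ b')
    (he1 : ∀ y ∈ ((((gr N).erase b).erase b').erase f).erase e, rk N {e, y} = 2)
    (hf1 : ∀ y ∈ ((((gr N).erase b).erase b').erase f).erase e, rk N {f, y} = 2)
    (hX : rk N (((((gr N).erase b).erase b').erase f).erase e) = 4) (hef2 : rk N {e, f} = 2)
    {P : Finset α → Prop} [DecidablePred P]
    (hP : ∀ W ∈ (d0DON N b' e f).filter P, ¬ (rk N (insert f ((W.erase b).erase e)) = 3 ∧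
      rk N (insert e (((((gr N).erase b).erase b').erase f).erase e \ (W.erase b).erase e)) = 4)) :
    ∀ W ∈ (d0DON N b' e f).filter P,
      (W.erase b).erase e ⊆ ((((gr N).erase b).erase b').erase f).erase e ∧ ((W.erase b).erase e).card = 2 ∧
      insert b (insert e ((W.erase b).erase e)) = W ∧ rk N (insert e ((W.erase b).erase e)) = 3 ∧
      rk N (insert f (((((gr N).erase b).erase b').erase f).erase e \ (W.erase b).erase e)) = 4 ∧
      ¬ (rk N (insert f ((W.erase b).erase e)) = 3 ∧
        rk N (insert e (((((gr N).erase b).erase b').erase f).erase e \ (W.erase b).erase e)) = 4) ∧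
      ∃ x ∈ (W.erase b).erase e, rk N {e, f, x} = 3 ∧ rk N ((((((gr N).erase b).erase b').erase f).erase e).erase x) = 4 := by
  have hXE : ((((gr N).erase b).erase b').erase f).erase e ⊆ ((gr N).erase b).erase b' :=
    (erase_subset _ _).trans (erase_subset _ _)
  have hfE : f ∈ ((gr N).erase b).erase b' := mem_erase.2 ⟨hfb', mem_erase.2 ⟨hfb, hf⟩⟩
  have hdata := d0_demand_data h hn hf hef heb hfb hfb' (e := e)
  intro W hW
  have hW' := hW
  simp only [d0DON, mem_filter] at hW'
  obtain ⟨⟨hWs, hPD, hcW⟩, -⟩ := hW'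
  obtain ⟨-, hπX, hπ2, hYeq, hWeq', hYr, hYc, -⟩ := hdata W hWs hPD hcW
  have hres := hP W hW
  refine ⟨hπX, hπ2, by rw [hYeq, hWeq'], hYr, hYc, hres, ?_⟩
  exact c_point_exists h hn he hf hef heb heb' hfb hfb' hef2 he1 hf1 hX hπX hπ2 hYr hYc hres

/-- The other endpoint of a defect `W` through a given point `c` of its pair. -/
theorem pair_of_defect {c : α} {π : Finset α} (hπ2 : π.card = 2) (hc : c ∈ π) :
    ∃ u, u ≠ c ∧ u ∈ π ∧ π = {c, u} := by
  obtain ⟨a, a', haa', heq⟩ := card_eq_two.1 hπ2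
  rw [heq] at hc
  simp only [mem_insert, mem_singleton] at hc
  rcases hc with rfl | rfl
  · exact ⟨a', haa'.symm, by rw [heq]; exact mem_insert_of_mem (mem_singleton_self _), heq⟩
  · exact ⟨a, haa', by rw [heq]; exact mem_insert_self _ _, by rw [heq, pair_comm']⟩

/-- **TWO DEFECTS SHARING THEIR UNIQUE C-ENDPOINT GIVE TWO MORE C-POINTS** (packaged on `d0DON`). -/
theorem two_more_cpoints_of_P (hn : (gr N).card = 9) (h : SeriesPair N b b')
    {e f : α} (he : e ∈ gr N) (hf : f ∈ gr N) (hef : e ≠ f) (heb : e ≠ b) (heb' : e ≠ b') (hfb : f ≠ b) (hfb' : f ≠ b')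
    (he1 : ∀ y ∈ ((((gr N).erase b).erase b').erase f).erase e, rk N {e, y} = 2)
    (hf1 : ∀ y ∈ ((((gr N).erase b).erase b').erase f).erase e, rk N {f, y} = 2)
    (hfc : ∀ y ∈ ((((gr N).erase b).erase b').erase f).erase e, rk N (((((gr N).erase b).erase b').erase f).erase y) = 4)
    (hX : rk N (((((gr N).erase b).erase b').erase f).erase e) = 4) (hef2 : rk N {e, f} = 2)
    {P : Finset α → Prop} [DecidablePred P]
    (hP : ∀ W ∈ (d0DON N b' e f).filter P, ¬ (rk N (insert f ((W.erase b).erase e)) = 3 ∧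
      rk N (insert e (((((gr N).erase b).erase b').erase f).erase e \ (W.erase b).erase e)) = 4))
    {W₁ W₂ : Finset α} (hW₁ : W₁ ∈ (d0DON N b' e f).filter P)
    (hW₂ : W₂ ∈ (d0DON N b' e f).filter P)
    {c u v : α} (hπ₁ : (W₁.erase b).erase e = {c, u}) (hπ₂ : (W₂.erase b).erase e = {c, v})
    (hcu : c ≠ u) (hcv : c ≠ v) (huv : u ≠ v)
    (hu : ¬ (rk N {e, f, u} = 3 ∧ rk N ((((((gr N).erase b).erase b').erase f).erase e).erase u) = 4))
    (hv : ¬ (rk N {e, f, v} = 3 ∧ rk N ((((((gr N).erase b).erase b').erase f).erase e).erase v) = 4)) :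
    ∃ p q : α, p ≠ q ∧ p ≠ c ∧ q ≠ c ∧ p ∈ ((((gr N).erase b).erase b').erase f).erase e ∧
      q ∈ ((((gr N).erase b).erase b').erase f).erase e ∧
      (rk N {e, f, p} = 3 ∧ rk N ((((((gr N).erase b).erase b').erase f).erase e).erase p) = 4) ∧
      (rk N {e, f, q} = 3 ∧ rk N ((((((gr N).erase b).erase b').erase f).erase e).erase q) = 4) := by
  have hb : b ∈ gr N := h.1
  have hb' : b' ∈ gr N := h.2.1
  have hbb' : b ≠ b' := h.2.2.1
  have heE : e ∈ ((gr N).erase b).erase b' := mem_erase.2 ⟨heb', mem_erase.2 ⟨heb, he⟩⟩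
  have hfE : f ∈ ((gr N).erase b).erase b' := mem_erase.2 ⟨hfb', mem_erase.2 ⟨hfb, hf⟩⟩
  have hX5 : (((((gr N).erase b).erase b').erase f).erase e).card = 5 := by
    rw [card_erase_of_mem (mem_erase.2 ⟨hef, heE⟩), card_erase_of_mem hfE,
      card_erase_of_mem (mem_erase.2 ⟨hbb'.symm, hb'⟩), card_erase_of_mem hb, hn]
  have hbadC := defect_data_of_P hn h he hf hef heb heb' hfb hfb' he1 hf1 hX hef2 hP
  obtain ⟨hπX₁, -, -, hY₁, hYc₁, hres₁, -⟩ := hbadC W₁ hW₁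
  obtain ⟨hπX₂, -, -, hY₂, hYc₂, hres₂, -⟩ := hbadC W₂ hW₂
  rw [hπ₁] at hπX₁ hY₁ hYc₁ hres₁
  rw [hπ₂] at hπX₂ hY₂ hYc₂ hres₂
  have hcX : c ∈ ((((gr N).erase b).erase b').erase f).erase e := hπX₁ (mem_insert_self _ _)
  have huX : u ∈ ((((gr N).erase b).erase b').erase f).erase e := hπX₁ (mem_insert_of_mem (mem_singleton_self _))
  have hvX : v ∈ ((((gr N).erase b).erase b').erase f).erase e := hπX₂ (mem_insert_of_mem (mem_singleton_self _))
  have hrest : (((((gr N).erase b).erase b').erase f).erase e \ {c, u, v}).card = 2 := by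
    rw [card_sdiff_of_subset (by
      intro a ha; simp only [mem_insert, mem_singleton] at ha
      rcases ha with rfl | rfl | rfl <;> assumption), hX5]
    rw [card_insert_of_notMem, card_pair huv]
    simp only [mem_insert, mem_singleton, not_or]; exact ⟨hcu, hcv⟩
  obtain ⟨p, q, hpq, hrest_eq⟩ := card_eq_two.1 hrest
  have hpR : p ∈ ((((gr N).erase b).erase b').erase f).erase e \ {c, u, v} := by
    rw [hrest_eq]; exact mem_insert_self _ _
  have hqR : q ∈ ((((gr N).erase b).erase b').erase f).erase e \ {c, u, v} := by
    rw [hrest_eq]; exact mem_insert_of_mem (mem_singleton_self _)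
  have hpX := (mem_sdiff.1 hpR).1
  have hqX := (mem_sdiff.1 hqR).1
  have hp3 := (mem_sdiff.1 hpR).2
  have hq3 := (mem_sdiff.1 hqR).2
  simp only [mem_insert, mem_singleton, not_or] at hp3 hq3
  have hXeq : ((((gr N).erase b).erase b').erase f).erase e = {c, u, v, p, q} := by
    ext a
    constructor
    · intro ha
      by_cases ha3 : a ∈ ({c, u, v} : Finset α)
      · simp only [mem_insert, mem_singleton] at ha3
        rcases ha3 with rfl | rfl | rfl
        · exact mem_insert_self _ _
        · exact mem_insert_of_mem (mem_insert_self _ _)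
        · exact mem_insert_of_mem (mem_insert_of_mem (mem_insert_self _ _))
      · have : a ∈ ((((gr N).erase b).erase b').erase f).erase e \ {c, u, v} := mem_sdiff.2 ⟨ha, ha3⟩
        rw [hrest_eq] at this
        simp only [mem_insert, mem_singleton] at this
        rcases this with rfl | rfl
        · exact mem_insert_of_mem (mem_insert_of_mem (mem_insert_of_mem (mem_insert_self _ _)))
        · exact mem_insert_of_mem (mem_insert_of_mem (mem_insert_of_mem (mem_insert_of_mem
            (mem_singleton_self _))))
    · intro ha
      simp only [mem_insert, mem_singleton] at ha
      rcases ha with rfl | rfl | rfl | rfl | rfl <;> assumption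
  have hsd1 : ((((gr N).erase b).erase b').erase f).erase e \ {c, u} = {v, p, q} := by
    rw [hXeq]
    exact quint_sdiff_xy hcv (Ne.symm hp3.1) (Ne.symm hq3.1) huv (Ne.symm hp3.2.1) (Ne.symm hq3.2.1)
  have hsd2 : ((((gr N).erase b).erase b').erase f).erase e \ {c, v} = {u, p, q} := by
    rw [hXeq, quint_swap23]
    exact quint_sdiff_xy hcu (Ne.symm hp3.1) (Ne.symm hq3.1) huv.symm (Ne.symm hp3.2.2) (Ne.symm hq3.2.2)
  rw [hsd1] at hYc₁ hres₁
  rw [hsd2] at hYc₂ hres₂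
  have hu' : ¬ (rk N {e, f, u} = 3 ∧ rk N {c, v, p, q} = 4) := by
    rw [← quint_erase_second hcu huv (Ne.symm hp3.2.1) (Ne.symm hq3.2.1), ← hXeq]; exact hu
  have hv' : ¬ (rk N {e, f, v} = 3 ∧ rk N {c, u, p, q} = 4) := by
    rw [← quint_erase_z hcv huv (Ne.symm hp3.2.2) (Ne.symm hq3.2.2), ← hXeq]; exact hv
  obtain ⟨⟨hefp, hXp⟩, hefq, hXq⟩ := cpoints_of_shared_endpoint he hf hef heb heb' he1 hf1 hfc hef2 hcu hcv
    (Ne.symm hp3.1) (Ne.symm hq3.1) huv (Ne.symm hp3.2.1) (Ne.symm hq3.2.1) (Ne.symm hp3.2.2)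
    (Ne.symm hq3.2.2) hpq huX hvX hpX hqX hXeq hY₁ hYc₁ hres₁ hY₂ hYc₂ hres₂ hu' hv'
  refine ⟨p, q, hpq, hp3.1, hq3.1, hpX, hqX, ⟨hefp, ?_⟩, ⟨hefq, ?_⟩⟩
  · rw [hXeq, quint_erase_fourth (Ne.symm hp3.1) (Ne.symm hp3.2.1) (Ne.symm hp3.2.2) hpq]; exact hXp
  · rw [hXeq, quint_erase_fifth (Ne.symm hq3.1) (Ne.symm hq3.2.1) (Ne.symm hq3.2.2) hpq]; exact hXq

/-- **AT MOST TWO DEFECTS ARE AT MOST THE C-POINT TARGETS** (loop regime). -/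
theorem card_bad_le_targets_of_card_le_two_P (hn : (gr N).card = 9) (h : SeriesPair N b b')
    {e f : α} (he : e ∈ gr N) (hf : f ∈ gr N) (hef : e ≠ f) (heb : e ≠ b) (heb' : e ≠ b') (hfb : f ≠ b) (hfb' : f ≠ b')
    (he1 : ∀ y ∈ ((((gr N).erase b).erase b').erase f).erase e, rk N {e, y} = 2)
    (hf1 : ∀ y ∈ ((((gr N).erase b).erase b').erase f).erase e, rk N {f, y} = 2)
    (hfc : ∀ y ∈ ((((gr N).erase b).erase b').erase f).erase e, rk N (((((gr N).erase b).erase b').erase f).erase y) = 4)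
    (hX : rk N (((((gr N).erase b).erase b').erase f).erase e) = 4) (hef2 : rk N {e, f} = 2)
    {P : Finset α → Prop} [DecidablePred P] {T : Finset (Finset α)}
    (hP : ∀ W ∈ (d0DON N b' e f).filter P, ¬ (rk N (insert f ((W.erase b).erase e)) = 3 ∧
      rk N (insert e (((((gr N).erase b).erase b').erase f).erase e \ (W.erase b).erase e)) = 4))
    (htgt : ∀ x ∈ ((((gr N).erase b).erase b').erase f).erase e, rk N {e, f, x} = 3 →
      rk N ((((((gr N).erase b).erase b').erase f).erase e).erase x) = 4 → insert b {e, f, x} ∈ T)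
    (h2 : ((d0DON N b' e f).filter P).card ≤ 2) :
    ((d0DON N b' e f).filter P).card ≤
      T.card := by
  have hb : b ∈ gr N := h.1
  have hb' : b' ∈ gr N := h.2.1
  have hbb' : b ≠ b' := h.2.2.1
  have heE : e ∈ ((gr N).erase b).erase b' := mem_erase.2 ⟨heb', mem_erase.2 ⟨heb, he⟩⟩
  have hfE : f ∈ ((gr N).erase b).erase b' := mem_erase.2 ⟨hfb', mem_erase.2 ⟨hfb, hf⟩⟩
  have hX5 : (((((gr N).erase b).erase b').erase f).erase e).card = 5 := by
    rw [card_erase_of_mem (mem_erase.2 ⟨hef, heE⟩), card_erase_of_mem hfE,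
      card_erase_of_mem (mem_erase.2 ⟨hbb'.symm, hb'⟩), card_erase_of_mem hb, hn]
  have hbadC := defect_data_of_P hn h he hf hef heb heb' hfb hfb' he1 hf1 hX hef2 hP
  rcases Nat.lt_or_ge ((d0DON N b' e f).filter P).card 1 with h0 | h1
  · omega
  · by_cases hcard : ((d0DON N b' e f).filter P).card = 1
    · obtain ⟨W, hW⟩ := card_pos.1 h1
      obtain ⟨hπX, -, -, -, -, -, x, hxπ, hefx, hx4⟩ := hbadC W hW
      have := card_pos.2 ⟨_, htgt x (hπX hxπ) hefx hx4⟩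
      omega
    · have hcard2 : ((d0DON N b' e f).filter P).card = 2 := by omega
      obtain ⟨W₁, W₂, hW12, hset⟩ := card_eq_two.1 hcard2
      have hW₁ : W₁ ∈ (d0DON N b' e f).filter P := by
        rw [hset]; exact mem_insert_self _ _
      have hW₂ : W₂ ∈ (d0DON N b' e f).filter P := by
        rw [hset]; exact mem_insert_of_mem (mem_singleton_self _)
      obtain ⟨hπX₁, hπ2₁, hWeq₁, hY₁, hYc₁, hres₁, x₁, hx₁π, hefx₁, hx₁4⟩ := hbadC W₁ hW₁
      obtain ⟨hπX₂, hπ2₂, hWeq₂, hY₂, hYc₂, hres₂, x₂, hx₂π, hefx₂, hx₂4⟩ := hbadC W₂ hW₂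
      by_cases hx12 : x₁ = x₂
      · -- the shared C-endpoint `c`
        subst hx12
        set c := x₁ with hcdef
        have hπne : (W₁.erase b).erase e ≠ (W₂.erase b).erase e := by
          intro h'; apply hW12; rw [← hWeq₁, ← hWeq₂, h']
        -- `π₁ = {c, u}`, `π₂ = {c, v}`
        obtain ⟨u, hu_mem, hπ₁eq⟩ : ∃ u ∈ (W₁.erase b).erase e, u ≠ c ∧ (W₁.erase b).erase e = {c, u} := by
          obtain ⟨a, a', haa', heq⟩ := card_eq_two.1 hπ2₁
          rw [heq] at hx₁π
          simp only [mem_insert, mem_singleton] at hx₁π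
          rcases hx₁π with rfl | rfl
          · exact ⟨a', by rw [heq]; exact mem_insert_of_mem (mem_singleton_self _), haa'.symm, heq⟩
          · exact ⟨a, by rw [heq]; exact mem_insert_self _ _, haa', by rw [heq, pair_comm']⟩
        obtain ⟨huc, hπ₁eq⟩ := hπ₁eq
        obtain ⟨v, hv_mem, hπ₂eq⟩ : ∃ v ∈ (W₂.erase b).erase e, v ≠ c ∧ (W₂.erase b).erase e = {c, v} := by
          obtain ⟨a, a', haa', heq⟩ := card_eq_two.1 hπ2₂
          rw [heq] at hx₂π
          simp only [mem_insert, mem_singleton] at hx₂π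
          rcases hx₂π with rfl | rfl
          · exact ⟨a', by rw [heq]; exact mem_insert_of_mem (mem_singleton_self _), haa'.symm, heq⟩
          · exact ⟨a, by rw [heq]; exact mem_insert_self _ _, haa', by rw [heq, pair_comm']⟩
        obtain ⟨hvc, hπ₂eq⟩ := hπ₂eq
        have huv : u ≠ v := by
          intro h'; apply hπne; rw [hπ₁eq, hπ₂eq, h']
        have hcX := hπX₁ hx₁π
        have huX := hπX₁ hu_mem
        have hvX := hπX₂ hv_mem
        by_cases hu : rk N {e, f, u} = 3 ∧ rk N ((((((gr N).erase b).erase b').erase f).erase e).erase u) = 4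
        · have h' := two_le_card_targets_of_P htgt huc huX hcX hu.1 hu.2 hefx₁ hx₁4
          omega
        by_cases hv : rk N {e, f, v} = 3 ∧ rk N ((((((gr N).erase b).erase b').erase f).erase e).erase v) = 4
        · have h' := two_le_card_targets_of_P htgt hvc hvX hcX hv.1 hv.2 hefx₁ hx₁4
          omega
        -- the two remaining points `p, q`
        have hrest : (((((gr N).erase b).erase b').erase f).erase e \ {c, u, v}).card = 2 := by
          rw [card_sdiff_of_subset (by
            intro a ha; simp only [mem_insert, mem_singleton] at ha
            rcases ha with rfl | rfl | rfl <;> assumption), hX5]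
          rw [card_insert_of_notMem, card_pair huv]
          simp only [mem_insert, mem_singleton, not_or]; exact ⟨huc.symm, hvc.symm⟩
        obtain ⟨p, q, hpq, hrest_eq⟩ := card_eq_two.1 hrest
        have hpR : p ∈ ((((gr N).erase b).erase b').erase f).erase e \ {c, u, v} := by
          rw [hrest_eq]; exact mem_insert_self _ _
        have hqR : q ∈ ((((gr N).erase b).erase b').erase f).erase e \ {c, u, v} := by
          rw [hrest_eq]; exact mem_insert_of_mem (mem_singleton_self _)
        have hpX := (mem_sdiff.1 hpR).1
        have hqX := (mem_sdiff.1 hqR).1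
        have hp3 := (mem_sdiff.1 hpR).2
        have hq3 := (mem_sdiff.1 hqR).2
        simp only [mem_insert, mem_singleton, not_or] at hp3 hq3
        have hXeq : ((((gr N).erase b).erase b').erase f).erase e = {c, u, v, p, q} := by
          ext a
          constructor
          · intro ha
            by_cases ha3 : a ∈ ({c, u, v} : Finset α)
            · simp only [mem_insert, mem_singleton] at ha3
              rcases ha3 with rfl | rfl | rfl
              · exact mem_insert_self _ _
              · exact mem_insert_of_mem (mem_insert_self _ _)
              · exact mem_insert_of_mem (mem_insert_of_mem (mem_insert_self _ _))
            · have : a ∈ ((((gr N).erase b).erase b').erase f).erase e \ {c, u, v} := mem_sdiff.2 ⟨ha, ha3⟩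
              rw [hrest_eq] at this
              simp only [mem_insert, mem_singleton] at this
              rcases this with rfl | rfl
              · exact mem_insert_of_mem (mem_insert_of_mem (mem_insert_of_mem (mem_insert_self _ _)))
              · exact mem_insert_of_mem (mem_insert_of_mem (mem_insert_of_mem (mem_insert_of_mem
                  (mem_singleton_self _))))
          · intro ha
            simp only [mem_insert, mem_singleton] at ha
            rcases ha with rfl | rfl | rfl | rfl | rfl <;> assumption
        -- the facts in the explicit form
        rw [hπ₁eq] at hY₁ hYc₁ hres₁
        rw [hπ₂eq] at hY₂ hYc₂ hres₂
        have hcu : c ≠ u := huc.symm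
        have hcv : c ≠ v := hvc.symm
        have hsd1 : ((((gr N).erase b).erase b').erase f).erase e \ {c, u} = {v, p, q} := by
          rw [hXeq]
          exact quint_sdiff_xy hcv (Ne.symm hp3.1) (Ne.symm hq3.1) huv (Ne.symm hp3.2.1) (Ne.symm hq3.2.1)
        have hsd2 : ((((gr N).erase b).erase b').erase f).erase e \ {c, v} = {u, p, q} := by
          rw [hXeq, quint_swap23]
          exact quint_sdiff_xy hcu (Ne.symm hp3.1) (Ne.symm hq3.1) huv.symm (Ne.symm hp3.2.2) (Ne.symm hq3.2.2)
        rw [hsd1] at hYc₁ hres₁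
        rw [hsd2] at hYc₂ hres₂
        have hu' : ¬ (rk N {e, f, u} = 3 ∧ rk N {c, v, p, q} = 4) := by
          rw [← quint_erase_second hcu huv (Ne.symm hp3.2.1) (Ne.symm hq3.2.1), ← hXeq]; exact hu
        have hv' : ¬ (rk N {e, f, v} = 3 ∧ rk N {c, u, p, q} = 4) := by
          rw [← quint_erase_z hcv huv (Ne.symm hp3.2.2) (Ne.symm hq3.2.2), ← hXeq]; exact hv
        obtain ⟨⟨hefp, hXp⟩, hefq, hXq⟩ := cpoints_of_shared_endpoint he hf hef heb heb' he1 hf1 hfc hef2 hcu hcv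
          (Ne.symm hp3.1) (Ne.symm hq3.1) huv (Ne.symm hp3.2.1) (Ne.symm hq3.2.1) (Ne.symm hp3.2.2)
          (Ne.symm hq3.2.2) hpq huX hvX hpX hqX hXeq hY₁ hYc₁ hres₁ hY₂ hYc₂ hres₂ hu' hv'
        have hp4 : rk N ((((((gr N).erase b).erase b').erase f).erase e).erase p) = 4 := by
          rw [hXeq, quint_erase_fourth (Ne.symm hp3.1) (Ne.symm hp3.2.1) (Ne.symm hp3.2.2) hpq]; exact hXp
        have hq4 : rk N ((((((gr N).erase b).erase b').erase f).erase e).erase q) = 4 := by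
          rw [hXeq, quint_erase_fifth (Ne.symm hq3.1) (Ne.symm hq3.2.1) (Ne.symm hq3.2.2) hpq]; exact hXq
        have h' := two_le_card_targets_of_P htgt hpq hpX hqX hefp hp4 hefq hq4
        omega
      · have h' := two_le_card_targets_of_P htgt hx12 (hπX₁ hx₁π) (hπX₂ hx₂π)
          hefx₁ hx₁4 hefx₂ hx₂4
        omega

/-- `{c, u, v, p, q} \ {u, v} = {c, p, q}`. -/
theorem quint_sdiff_uv {c u v p q : α} (hcu : c ≠ u) (hcv : c ≠ v) (hup : u ≠ p) (huq : u ≠ q) (hvp : v ≠ p)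
    (hvq : v ≠ q) : ({c, u, v, p, q} : Finset α) \ {u, v} = {c, p, q} := by
  ext a; simp only [mem_sdiff, mem_insert, mem_singleton]
  constructor
  · rintro ⟨h1, h2⟩; tauto
  · rintro (rfl | rfl | rfl)
    · exact ⟨by tauto, by rintro (rfl | rfl) <;> simp_all⟩
    · exact ⟨by tauto, by rintro (rfl | rfl) <;> simp_all⟩
    · exact ⟨by tauto, by rintro (rfl | rfl) <;> simp_all⟩

/-- `{c, u, v, w, p} \ {u, w} = {c, v, p}`. -/
theorem quint_sdiff_uw {c u v w p : α} (hcu : c ≠ u) (hcw : c ≠ w) (huv : u ≠ v) (hup : u ≠ p) (hvw : v ≠ w)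
    (hwp : w ≠ p) : ({c, u, v, w, p} : Finset α) \ {u, w} = {c, v, p} := by
  ext a; simp only [mem_sdiff, mem_insert, mem_singleton]
  constructor
  · rintro ⟨h1, h2⟩; tauto
  · rintro (rfl | rfl | rfl)
    · exact ⟨by tauto, by rintro (rfl | rfl) <;> simp_all⟩
    · exact ⟨by tauto, by rintro (rfl | rfl) <;> simp_all⟩
    · exact ⟨by tauto, by rintro (rfl | rfl) <;> simp_all⟩


end StarSharpDefectA

end PercRepro.Cogirth
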